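import Literature.MathematicalPhysics.QuantumLattice.GibbsKMSMomentCutsSector
import Literature.MathematicalPhysics.QuantumLattice.TorusGibbsMatrixCuts
import HarnessLib

/-!
# KMS moment cuts, III: the translated canonical Gibbs mixtures of the `t–t'` torus and the
# pull-back of iterated commutators with the torus Hamiltonian

Topic `Literature/MathematicalPhysics/QuantumLattice`; torus packaging of `GibbsKMSMomentCuts(Sector).lean`
along the lines of `TorusGibbsMatrixCuts.lean` (the `K = 1` case). A KMS moment cut
`R(A, a) = Σ_k Σ_{ij} β^k [(P_k)_{ij} · a_iᴴ ad_A^k(a_j) + (Q_k)_{ij} · ad_A^k(a_j) a_iᴴ]`,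
`ad_A(X) = AX − XA`, is nonnegative in every canonical sector Gibbs eigen-mixture of `A` with
sector-preserving generators as soon as `Σ_k u^k P_k + e^{−u} Σ_k u^k Q_k ⪰ 0` for every real `u`
(`sum_canonicalWeight_mul_re_expect_momentCut_nonneg`).

* §1 unitary covariance: `Uᴴ ad_A^k(X) U = ad_A^k(UᴴXU)` for `U` commuting with `A`
  (`conjTranspose_mul_iterate_commutator_mul_of_commute`), hence `Uᴴ R(A, a) U = R(A, UᴴaU)`
  (`conjTranspose_mul_momentCut_mul_of_commute`) and the cut in unitarily transformed sector mixtures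
  (`sum_canonicalWeight_mul_re_expect_momentCut_mulVec_nonneg`).
* §2 the translated canonical Gibbs mixtures `(p_{L,c}, U_vψ_{L,c})` of `hubbardTorusTT' L t t' U` on
  `(rectN n L, S^z = 0)`, for torus generators commuting with `N` and `S^z`
  (`sum_sectorGibbsWeightTT'_mul_re_expect_momentCut_fockTranslate_nonneg`).
* §3 THE PULL-BACK OF ITERATED COMMUTATORS: for a region `Λ`, a window `Λ' ⊇ (thicken · 1)^[k] Λ` with
  `x ↦ x mod L` injective on `thicken Λ' 1`, and a local `A ∈ 𝔄_Λ`,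
  `ad_{H_L}^k(Γ Γ_{Λ⊆Λ'}A) = Γ(ad_{H_{Λ'}}^k(Γ_{Λ⊆Λ'}A))`
  (`iterate_hubbardTorusTT'_commutator_fermionEmbed`; induction on `k` through the one-step torus form
  `hubbardTorusTT'_commutator_fermionEmbed` and the region form
  `hubbardTTPrime_localHamiltonian_commutator_fermionEmbed_eq` of Bratteli–Robinson II Thm. 6.2.4, the
  support growing by one king-move shell per commutator), with the bookkeeping
  `subset_iterate_thicken_one`, `iterate_thicken_one_subset_of_le`; and the WINDOW INDEPENDENCE of the local
  iterated commutator (`fermionEmbed_iterate_localHamiltonian_commutator`: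
  `Γ_{Λ'⊆Λ''}(ad_{H_{Λ'}}^k Γ_{Λ⊆Λ'}A) = ad_{H_{Λ''}}^k(Γ_{Λ⊆Λ''}A)`).

The translation average of the embedded local cut and the rows of thermal torus-limit states follow in
`InfVolFermionStateTorusLimitKMSMomentCuts.lean`. Everything is PROVED; no definition, no named fact.

## Mathlib / tree search

REUSED: `sum_canonicalWeight_mul_re_expect_momentCut_nonneg` (`GibbsKMSMomentCutsSector`),
`conjTranspose_mul_iterate_commutator_mul` (`GibbsKMSMomentCuts`), `mul_apply_eq_zero_off`
(`GibbsEnergyEntropyBalance`), `star_mulVec_dotProduct_mulVec_mulVec` (`CompressedFormOnSector`),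
`fockTranslate_val_conjTranspose_mul_val_mul`, `…_mul_val_conjTranspose_mul`, `fockTranslate_apply_eq_zero_of_szConfig`,
`fockTranslate_val_conjTranspose_eq_neg`, `apply_eq_zero_of_szConfig_of_commute`,
`conjTranspose_apply_eq_zero_of_szConfig_of_commute` (`TorusGibbsEnergyEntropyBalance`),
`hubbardTorusTT'_commutator_fermionEmbed` (`HubbardNNNHoppingLocalHamiltonian`),
`hubbardTTPrime_localHamiltonian_commutator_fermionEmbed_eq` (`HubbardTTPrimeWindowCertificateAbstractState`),
`subset_thicken`, `fermionEmbed_fermionEmbed`, `PolySite.incl_trans` (`InfiniteVolumeStates` / `InfVolFermionState`).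
`lean search 'iterate.*localHamiltonian|ad_.*\^\[k\].*fermionEmbed'`: nothing (2026-08-27).

## References

* C. Itoi, H. Ishimori, K. Sato, Y. Sakamoto, J. Phys. Soc. Jpn. 92 (2023) 074001 = arXiv:2306.03489, §2
  (the operators `C_A^k = [H,[H,…[H,A]…]]`). [cite: ItoiEtAl2023, Lemma 5]
* O. Bratteli, D. W. Robinson, *OAQSM 2* (1997), Thm. 6.2.4 (`δ(A) = i[H_{Λ'}, A]` for every window
  containing the range-neighbourhood of the support; iterates `δ^k`). [cite: BratteliRobinsonII1997, Thm. 6.2.4]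
* H. Fawzi, O. Fawzi, S. O. Scalet, Nat. Commun. 15 (2024) 7394 = arXiv:2311.18706, §3.2 (opt2).
  [cite: FawziFawziScalet2024, Thm. 3.4]
-/

noncomputable section

namespace Literature.MathematicalPhysics.QuantumLattice

open Matrix Finset HubbardWave0 Literature.Probability.LatticeModels ThermodynamicLimit
open _root_.Filter
open scoped _root_.Topology ComplexOrder BigOperators

/-! ### §1 Unitary covariance of KMS moment cuts -/

section Covariance

variable {ι : Type*} [Fintype ι] [DecidableEq ι]
variable {m : Type*} [Fintype m]

omit [DecidableEq ι] in
/-- **Unitary covariance of iterated commutators**: for `U` with `Uᴴ(UX) = X = U(UᴴX)` commuting with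
`A`, `Uᴴ ad_A^k(X) U = ad_A^k(Uᴴ X U)` (instance-free form of `conjTranspose_mul_iterate_commutator_mul`).
[cite: ItoiEtAl2023, Lemma 5] -/
theorem conjTranspose_mul_iterate_commutator_mul_of_commute {U A : Matrix ι ι ℂ}
    (hU : ∀ X : Matrix ι ι ℂ, Uᴴ * (U * X) = X) (hU' : ∀ X : Matrix ι ι ℂ, U * (Uᴴ * X) = X)
    (hUA : Commute U A) (X : Matrix ι ι ℂ) (k : ℕ) :
    Uᴴ * ((fun Y : Matrix ι ι ℂ => A * Y - Y * A)^[k] X) * U =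
      (fun Y : Matrix ι ι ℂ => A * Y - Y * A)^[k] (Uᴴ * X * U) := by
  have hconj : ∀ Y Z : Matrix ι ι ℂ, Uᴴ * (Y * Z) * U = (Uᴴ * Y * U) * (Uᴴ * Z * U) := by
    intro Y Z
    calc Uᴴ * (Y * Z) * U = Uᴴ * Y * (Z * U) := by simp only [Matrix.mul_assoc]
      _ = Uᴴ * Y * (U * (Uᴴ * (Z * U))) := by rw [hU']
      _ = (Uᴴ * Y * U) * (Uᴴ * Z * U) := by simp only [Matrix.mul_assoc]
  have hA : Uᴴ * A * U = A := by rw [Matrix.mul_assoc, ← hUA.eq, hU]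
  induction k with
  | zero => rfl
  | succ k ih =>
    rw [Function.iterate_succ_apply', Function.iterate_succ_apply', ← ih, Matrix.mul_sub, Matrix.sub_mul,
      hconj, hconj, hA]

omit [DecidableEq ι] in
/-- **Unitary covariance of a KMS moment cut**: for `U` with `Uᴴ(UX) = X = U(UᴴX)` commuting with `A`,
`Uᴴ R(A, a) U = R(A, UᴴaU)` for
`R(A, a) = Σ_k Σ_{ij} β^k [(P_k)_{ij} · a_iᴴ ad_A^k(a_j) + (Q_k)_{ij} · ad_A^k(a_j) a_iᴴ]`.
[cite: FawziFawziScalet2024, Thm. 3.4] -/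
theorem conjTranspose_mul_momentCut_mul_of_commute {U A : Matrix ι ι ℂ} (hU : ∀ X : Matrix ι ι ℂ, Uᴴ * (U * X) = X)
    (hU' : ∀ X : Matrix ι ι ℂ, U * (Uᴴ * X) = X) (hUA : Commute U A) (a : m → Matrix ι ι ℂ) (β : ℝ)
    {K : ℕ} (P Q : Fin (K + 1) → Matrix m m ℂ) :
    Uᴴ * (∑ k : Fin (K + 1), ∑ i, ∑ j,
        ((((β ^ (k : ℕ) : ℝ) : ℂ) * P k i j) • ((a i)ᴴ * (fun X : Matrix ι ι ℂ => A * X - X * A)^[(k : ℕ)] (a j)) +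
          (((β ^ (k : ℕ) : ℝ) : ℂ) * Q k i j) • ((fun X : Matrix ι ι ℂ => A * X - X * A)^[(k : ℕ)] (a j) * (a i)ᴴ))) * U =
      ∑ k : Fin (K + 1), ∑ i, ∑ j,
        ((((β ^ (k : ℕ) : ℝ) : ℂ) * P k i j) •
            ((Uᴴ * a i * U)ᴴ * (fun X : Matrix ι ι ℂ => A * X - X * A)^[(k : ℕ)] (Uᴴ * a j * U)) +
          (((β ^ (k : ℕ) : ℝ) : ℂ) * Q k i j) •
            ((fun X : Matrix ι ι ℂ => A * X - X * A)^[(k : ℕ)] (Uᴴ * a j * U) * (Uᴴ * a i * U)ᴴ)) := by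
  have hconj : ∀ Y Z : Matrix ι ι ℂ, Uᴴ * (Y * Z) * U = (Uᴴ * Y * U) * (Uᴴ * Z * U) := by
    intro Y Z
    calc Uᴴ * (Y * Z) * U = Uᴴ * Y * (Z * U) := by simp only [Matrix.mul_assoc]
      _ = Uᴴ * Y * (U * (Uᴴ * (Z * U))) := by rw [hU']
      _ = (Uᴴ * Y * U) * (Uᴴ * Z * U) := by simp only [Matrix.mul_assoc]
  have hat : ∀ i, (Uᴴ * a i * U)ᴴ = Uᴴ * (a i)ᴴ * U := fun i => by
    rw [conjTranspose_mul, conjTranspose_mul, conjTranspose_conjTranspose, Matrix.mul_assoc]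
  have had : ∀ (j : m) (k : ℕ), Uᴴ * ((fun Y : Matrix ι ι ℂ => A * Y - Y * A)^[k] (a j)) * U =
      (fun Y : Matrix ι ι ℂ => A * Y - Y * A)^[k] (Uᴴ * a j * U) := fun j k =>
    conjTranspose_mul_iterate_commutator_mul_of_commute hU hU' hUA (a j) k
  rw [Matrix.mul_sum, Matrix.sum_mul]
  refine Finset.sum_congr rfl fun k _ => ?_
  rw [Matrix.mul_sum, Matrix.sum_mul]
  refine Finset.sum_congr rfl fun i _ => ?_
  rw [Matrix.mul_sum, Matrix.sum_mul]
  refine Finset.sum_congr rfl fun j _ => ?_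
  rw [Matrix.mul_add, Matrix.add_mul, Matrix.mul_smul, Matrix.smul_mul, Matrix.mul_smul, Matrix.smul_mul,
    hconj, hconj, had, hat]

variable (p : ι → Prop) [DecidablePred p]

/-- **KMS moment cuts for unitarily transformed canonical sector eigen-mixtures**: under the hypotheses of
`sum_canonicalWeight_mul_re_expect_momentCut_nonneg`, if `U` satisfies `Uᴴ(UX) = X = U(UᴴX)`, commutes
with `A`, and `U`, `Uᴴ` preserve the sector, the mixture `(w_c, Uψ_c)` satisfies the same inequality
(covariance: it is the cut of the sector-preserving generators `Uᴴ a_i U`). [cite: FawziFawziScalet2024, Thm. 3.4] -/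
theorem sum_canonicalWeight_mul_re_expect_momentCut_mulVec_nonneg {A : Matrix ι ι ℂ} (hA : A.IsHermitian)
    (hinv : ∀ i j, ¬ p i → p j → A i j = 0) {U : Matrix ι ι ℂ} (hU : ∀ X : Matrix ι ι ℂ, Uᴴ * (U * X) = X)
    (hU' : ∀ X : Matrix ι ι ℂ, U * (Uᴴ * X) = X) (hUA : Commute U A)
    (hUp : ∀ i j, ¬ p i → p j → U i j = 0) (hUp' : ∀ i j, ¬ p i → p j → Uᴴ i j = 0)
    {a : m → Matrix ι ι ℂ} (ha : ∀ l i j, ¬ p i → p j → a l i j = 0)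
    (ha' : ∀ l i j, ¬ p i → p j → (a l)ᴴ i j = 0) (β : ℝ) {K : ℕ} {P Q : Fin (K + 1) → Matrix m m ℂ}
    (hPi : ∀ u : ℝ, (∑ k : Fin (K + 1), ((u ^ (k : ℕ) : ℝ) : ℂ) • P k +
        ((Real.exp (-u) : ℝ) : ℂ) • ∑ k : Fin (K + 1), ((u ^ (k : ℕ) : ℝ) : ℂ) • Q k).PosSemidef) :
    0 ≤ ∑ c, canonicalWeight β (sectorEigenvalue p A hA) c *
      (star (U *ᵥ sectorEigenvector p A hA c) ⬝ᵥ
        ((∑ k : Fin (K + 1), ∑ i, ∑ j,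
            ((((β ^ (k : ℕ) : ℝ) : ℂ) * P k i j) • ((a i)ᴴ * (fun X : Matrix ι ι ℂ => A * X - X * A)^[(k : ℕ)] (a j)) +
              (((β ^ (k : ℕ) : ℝ) : ℂ) * Q k i j) • ((fun X : Matrix ι ι ℂ => A * X - X * A)^[(k : ℕ)] (a j) * (a i)ᴴ))) *ᵥ
          (U *ᵥ sectorEigenvector p A hA c))).re := by
  have hb : ∀ l i j, ¬ p i → p j → (Uᴴ * a l * U) i j = 0 := fun l =>
    mul_apply_eq_zero_off p (mul_apply_eq_zero_off p hUp' (ha l)) hUp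
  have hb' : ∀ l i j, ¬ p i → p j → (Uᴴ * a l * U)ᴴ i j = 0 := fun l => by
    have h : (Uᴴ * a l * U)ᴴ = Uᴴ * (a l)ᴴ * U := by
      rw [conjTranspose_mul, conjTranspose_mul, conjTranspose_conjTranspose, Matrix.mul_assoc]
    rw [h]
    exact mul_apply_eq_zero_off p (mul_apply_eq_zero_off p hUp' (ha' l)) hUp
  refine (sum_canonicalWeight_mul_re_expect_momentCut_nonneg p hA hinv hb hb' β hPi).trans_eq
    (Finset.sum_congr rfl fun c _ => ?_)
  rw [star_mulVec_dotProduct_mulVec_mulVec U _ (sectorEigenvector p A hA c) (sectorEigenvector p A hA c),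
    conjTranspose_mul_momentCut_mul_of_commute hU hU' hUA a β P Q]

end Covariance

/-! ### §2 The translated canonical Gibbs mixtures of the `t–t'` torus -/

section Torus

variable (L : ℕ) [NeZero L] {m : Type*} [Fintype m]

/-- **KMS moment cuts in the translated canonical Gibbs mixtures of the torus**: for
`H_L = hubbardTorusTT' L t t' U`, the canonical Gibbs data of `(rectN n L, S^z = 0)`, a translation `v`,
generators `b_i` commuting with `N` and `S^z`, and coefficient matrices with
`Σ_k u^k P_k + e^{−u} Σ_k u^k Q_k ⪰ 0` for all real `u`:
`0 ≤ Σ_c p_{L,c} Re⟨U_vψ_{L,c}, R(H_L, b) U_vψ_{L,c}⟩`. No hypothesis on `β, t, t', U, n`.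
[cite: FawziFawziScalet2024, Thm. 3.4] [cite: ItoiEtAl2023, Lemma 5] -/
theorem sum_sectorGibbsWeightTT'_mul_re_expect_momentCut_fockTranslate_nonneg (t t' U n β : ℝ)
    (v : TorusSite 2 L) {b : m → Matrix (Finset (Orb (FermionTorus 2 L))) (Finset (Orb (FermionTorus 2 L))) ℂ}
    (hbN : ∀ i, Commute (b i) totalNumber) (hbS : ∀ i, Commute (b i) HubbardWave0.spinZ)
    {K : ℕ} {P Q : Fin (K + 1) → Matrix m m ℂ}
    (hPi : ∀ u : ℝ, (∑ k : Fin (K + 1), ((u ^ (k : ℕ) : ℝ) : ℂ) • P k +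
        ((Real.exp (-u) : ℝ) : ℂ) • ∑ k : Fin (K + 1), ((u ^ (k : ℕ) : ℝ) : ℂ) • Q k).PosSemidef) :
    0 ≤ ∑ c, sectorGibbsWeightTT' β t t' U n L c *
      (star ((fockTranslate v).val *ᵥ sectorGibbsVectorTT' t t' U n L c) ⬝ᵥ
        ((∑ k : Fin (K + 1), ∑ i, ∑ j,
            ((((β ^ (k : ℕ) : ℝ) : ℂ) * P k i j) • ((b i)ᴴ *
                (fun X => hubbardTorusTT' L t t' U * X - X * hubbardTorusTT' L t t' U)^[(k : ℕ)] (b j)) +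
              (((β ^ (k : ℕ) : ℝ) : ℂ) * Q k i j) •
                ((fun X => hubbardTorusTT' L t t' U * X - X * hubbardTorusTT' L t t' U)^[(k : ℕ)] (b j) * (b i)ᴴ))) *ᵥ
          ((fockTranslate v).val *ᵥ sectorGibbsVectorTT' t t' U n L c))).re := by
  set H := hubbardTorusTT' L t t' U with hH
  have hA : H.IsHermitian := hubbardTorusTT'_isHermitian L t t' U
  have hinv : ∀ s s', ¬ szConfig n L s → szConfig n L s' → H s s' = 0 :=
    fun s s' hs hs' => hubbardTorusTT'_apply_eq_zero_of_szConfig L t t' U n s s' hs hs'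
  have hUp' : ∀ s s', ¬ szConfig n L s → szConfig n L s' → (fockTranslate v).valᴴ s s' = 0 := by
    intro s s' hs hs'
    rw [fockTranslate_val_conjTranspose_eq_neg]
    exact fockTranslate_apply_eq_zero_of_szConfig L (-v) n s s' hs hs'
  have key := sum_canonicalWeight_mul_re_expect_momentCut_mulVec_nonneg (szConfig n L) hA hinv
    (fockTranslate_val_conjTranspose_mul_val_mul L v) (fockTranslate_val_mul_val_conjTranspose_mul L v)
    (fockTranslate_commute_hubbardTorusTT' L v t t' U)
    (fun s s' hs hs' => fockTranslate_apply_eq_zero_of_szConfig L v n s s' hs hs') hUp'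
    (fun i => apply_eq_zero_of_szConfig_of_commute L n (hbN i) (hbS i))
    (fun i => conjTranspose_apply_eq_zero_of_szConfig_of_commute L n (hbN i) (hbS i)) β hPi
  set e := sectorGibbsIndex n L with he
  refine key.trans_eq ?_
  rw [← Equiv.sum_comp e]
  refine Finset.sum_congr rfl fun c _ => ?_
  have hw : sectorGibbsWeightTT' β t t' U n L c = canonicalWeight β (sectorEigenvalue (szConfig n L) H hA) (e c) := by
    rw [sectorGibbsWeightTT', show sectorGibbsEnergyTT' t t' U n L =
      sectorEigenvalue (szConfig n L) H hA ∘ e from rfl]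
    unfold canonicalWeight
    rw [show (∑ b', Real.exp (-(β * (sectorEigenvalue (szConfig n L) H hA ∘ e) b'))) =
      ∑ b', Real.exp (-(β * sectorEigenvalue (szConfig n L) H hA b')) from
      Equiv.sum_comp e (fun b' => Real.exp (-(β * sectorEigenvalue (szConfig n L) H hA b')))]
    rfl
  rw [hw]
  rfl

end Torus

/-! ### §3 Iterated commutators with the torus Hamiltonian pull back to the window -/

section PullBack

/-- `Λ ⊆ (thicken · 1)^[k] Λ`. [cite: BratteliRobinsonII1997, Thm. 6.2.4] -/
theorem subset_iterate_thicken_one {d : ℕ} (k : ℕ) :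
    ∀ Λ : Finset (Site d), Λ ⊆ (fun S : Finset (Site d) => thicken S 1)^[k] Λ := by
  induction k with
  | zero => intro Λ; exact subset_rfl
  | succ k ih =>
    intro Λ
    rw [Function.iterate_succ_apply]
    exact (subset_thicken Λ 1).trans (ih (thicken Λ 1))

/-- Monotonicity in the number of shells: `(thicken · 1)^[k] Λ ⊆ (thicken · 1)^[K] Λ` for `k ≤ K`.
[cite: BratteliRobinsonII1997, Thm. 6.2.4] -/
theorem iterate_thicken_one_subset_of_le {d : ℕ} {k K : ℕ} (hk : k ≤ K) (Λ : Finset (Site d)) :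
    (fun S : Finset (Site d) => thicken S 1)^[k] Λ ⊆ (fun S : Finset (Site d) => thicken S 1)^[K] Λ := by
  obtain ⟨e, rfl⟩ := Nat.exists_eq_add_of_le hk
  rw [add_comm, Function.iterate_add_apply]
  exact subset_iterate_thicken_one e _

variable (L : ℕ) [NeZero L] (t t' U : ℝ)

/-- **Window independence of the local iterated commutator**: for `Λ ⊆ Λ' ⊆ Λ''` with
`(thicken · 1)^[k] Λ ⊆ Λ'`, `Γ_{Λ'⊆Λ''}(ad_{H_{Λ'}}^k(Γ_{Λ⊆Λ'}A)) = ad_{H_{Λ''}}^k(Γ_{Λ⊆Λ''}A)` for the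
free-boundary `t–t'–U` Hamiltonians (`k` applications of Bratteli–Robinson II Thm. 6.2.4: the terms of
`H_{Λ''}` outside the `k`-th king-move shell of `Λ` never act). [cite: BratteliRobinsonII1997, Thm. 6.2.4] -/
theorem fermionEmbed_iterate_localHamiltonian_commutator :
    ∀ (k : ℕ) {Λ Λ' Λ'' : Finset (Site 2)} (hΛ : Λ ⊆ Λ') (h' : Λ' ⊆ Λ'')
      (_hk : (fun S : Finset (Site 2) => thicken S 1)^[k] Λ ⊆ Λ') (A : FermionOp Λ),
      fermionEmbed (PolySite.incl h')
          ((fun Y : FermionOp Λ' => (hubbardTTPrimeFermionInteraction t t' U).localHamiltonian Λ' * Y -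
              Y * (hubbardTTPrimeFermionInteraction t t' U).localHamiltonian Λ')^[k]
            (fermionEmbed (PolySite.incl hΛ) A)) =
        (fun Y : FermionOp Λ'' => (hubbardTTPrimeFermionInteraction t t' U).localHamiltonian Λ'' * Y -
            Y * (hubbardTTPrimeFermionInteraction t t' U).localHamiltonian Λ'')^[k]
          (fermionEmbed (PolySite.incl (hΛ.trans h')) A) := by
  intro k
  induction k with
  | zero =>
    intro Λ Λ' Λ'' hΛ h' _ A
    simp only [Function.iterate_zero, id_eq, fermionEmbed_fermionEmbed, PolySite.incl_trans]
  | succ k ih =>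
    intro Λ Λ' Λ'' hΛ h' hk A
    have h8 : thicken Λ 1 ⊆ Λ' := (subset_iterate_thicken_one k (thicken Λ 1)).trans hk
    rw [Function.iterate_succ_apply, Function.iterate_succ_apply,
      hubbardTTPrime_localHamiltonian_commutator_fermionEmbed_eq t t' U hΛ h8 A,
      hubbardTTPrime_localHamiltonian_commutator_fermionEmbed_eq t t' U (hΛ.trans h') (h8.trans h') A,
      ih h8 h' hk]

/-- **Iterated commutators with the `t–t'` torus Hamiltonian pull back to the window.** For a region
`Λ`, a window `Λ' ⊇ Λ` containing the `k`-th king-move shell `(thicken · 1)^[k] Λ`, `x ↦ x mod L` injective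
on `thicken Λ' 1`, and a local `A ∈ 𝔄_Λ`:
`ad_{H_L}^k(Γ(Γ_{Λ⊆Λ'}A)) = Γ(ad_{H_{Λ'}}^k(Γ_{Λ⊆Λ'}A))`, `Γ` the embedding of `𝔄_{Λ'}` into the torus —
`k` applications of `[H_L, ΓB] = Γ[H_{Λ'}, B]` (Bratteli–Robinson II Thm. 6.2.4 on the torus), the support
of the intermediate commutators growing by one shell each time. These are the words `C_A^k = [H,[H,…[H,A]…]]`
of the KMS moment rows. [cite: BratteliRobinsonII1997, Thm. 6.2.4] [cite: ItoiEtAl2023, Lemma 5] -/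
theorem iterate_hubbardTorusTT'_commutator_fermionEmbed :
    ∀ (k : ℕ) {Λ Λ' : Finset (Site 2)} (hΛ : Λ ⊆ Λ')
      (_hk : (fun S : Finset (Site 2) => thicken S 1)^[k] Λ ⊆ Λ')
      (hInj : Set.InjOn (Torus.proj (d := 2) L) ↑(thicken Λ' 1)) (A : FermionOp Λ),
      (fun X => hubbardTorusTT' L t t' U * X - X * hubbardTorusTT' L t t' U)^[k]
          (fermionEmbed (PolySite.toTorusEmb L (hInj.mono (by exact_mod_cast subset_thicken Λ' 1)))
            (fermionEmbed (PolySite.incl hΛ) A)) =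
        fermionEmbed (PolySite.toTorusEmb L (hInj.mono (by exact_mod_cast subset_thicken Λ' 1)))
          ((fun Y : FermionOp Λ' => (hubbardTTPrimeFermionInteraction t t' U).localHamiltonian Λ' * Y -
              Y * (hubbardTTPrimeFermionInteraction t t' U).localHamiltonian Λ')^[k]
            (fermionEmbed (PolySite.incl hΛ) A)) := by
  intro k
  induction k with
  | zero => intro Λ Λ' hΛ _ hInj A; rfl
  | succ k ih =>
    intro Λ Λ' hΛ hk hInj A
    have h8 : thicken Λ 1 ⊆ Λ' := (subset_iterate_thicken_one k (thicken Λ 1)).trans hk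
    rw [Function.iterate_succ_apply, Function.iterate_succ_apply,
      hubbardTorusTT'_commutator_fermionEmbed L t t' U hΛ h8 hInj A,
      hubbardTTPrime_localHamiltonian_commutator_fermionEmbed_eq t t' U hΛ h8 A]
    exact ih h8 hk hInj _

end PullBack

end Literature.MathematicalPhysics.QuantumLattice

end
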